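import Summits.ResolutionOfSingularities.ResolutionOfSingularities.Theorems.FrobeniusClosingPatchingRelPerfectDepthPhaseCContactSingBridge
import Summits.ResolutionOfSingularities.ResolutionOfSingularities.Theorems.FrobeniusClosingPatchingRelPerfectDepthPhaseCContactLegality
import Literature.AlgebraicGeometry.Resolution.NormalCrossingsStrictification
import Literature.AlgebraicGeometry.Resolution.NormalCrossingsBlowupStepReductionProofs
import Literature.AlgebraicGeometry.Resolution.NormalCrossingsLocal
import Literature.AlgebraicGeometry.Resolution.RegularLocalRingsQuotient
import Literature.AlgebraicGeometry.Resolution.RegularLocalRingsProofs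
import Literature.AlgebraicGeometry.Resolution.MarkedIdealsLemmas
import Literature.AlgebraicGeometry.Resolution.MarkedIdealsArithmetic
import Literature.AlgebraicGeometry.Resolution.StalkIdealLemmas
import Mathlib.RingTheory.KrullDimension.Regular
import Mathlib.Data.List.Prime
import HarnessLib

/-!
# Crux `PatchingRelPerfect` (stmt-ResolutionOfSingularities-16161), chain W5.2 — F7(β) (β-AX) X3 C-I (M2b) cure §1b′: THE CONTACT SURFACE HAS
# DIMENSION ≤ 2 (the hypothesis `hdim` of `exists_realisedCure_of_F60`, from K21 and the patch-uniform rev-6 contact data)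

[OURS · L1 W5.2 · cure plan of record (res-L1-w52-lead-1 g6).]  Replaces the role of NO printed item; NOT a statement of the manuscript under
review (AI-written; AI review weaker than expert review; counted 0).  Def-free, fact-free.

* `ringKrullDim_quot_le_of_two_parameters` — LOCAL ALGEBRA: `R` regular local, `w ∈ 𝔪 ∖ 𝔪²`, `ψ ∈ 𝔪 ∖ (w)`, `(w) + (ψ) ≤ I`, `dim R ≤ n + 2` ⟹
  `dim R/I ≤ n` (`(w)` is prime, `w` and then `ψ̄` are non-zero-divisors: Mathlib `ringKrullDim_quotient_span_singleton_succ_eq_ringKrullDim` twice).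
* `topologicalKrullDim_contactSurface_le_two` — for `X` regular with `dim X ≤ 4` (K21), a closed `Sfc` and an open `W` such that every point
  `z ∈ Sfc ∩ W` carries the rev-6 patch data (order-one principal carrier `V ∋ z`, stalkwise principal entries, NF0 at `z`, and
  `Sfc ∩ W' ⊆ Supp V ∩ ⋃_{Φ ≠ V} Supp Φ` on a neighbourhood `W'`): the reduced closed subscheme `(Sfc ∩ W)_red` of `W` has `topologicalKrullDim ≤ 2`
  (`dim = sup` of local dimensions, `Scheme.topologicalKrullDim_eq_iSup_ringKrullDim_stalk`; the local ring of `(Sfc ∩ W)_red` at a point is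
  `𝒪_{X,z} ⧸ 𝓘(Sfc)_z`, a quotient of `𝒪_{X,z} ⧸ (w, ∏ φ)`).

## References
* H. Matsumura, *Commutative Ring Theory* (1987), Thm. 14.2, Thm. 17.4. [Matsumura1987]
* U. Görtz, T. Wedhorn, *Algebraic Geometry I* (2nd ed. 2020), Lemma 5.7 (4). [GortzWedhorn2020]
-/

-- `Summit.<Summit>.<Sub>.Theorems` with `Sub = Summit` (single-conjunct summit, D-0017)
set_option linter.dupNamespace false

noncomputable section

namespace Summit.ResolutionOfSingularities.ResolutionOfSingularities.Theorems.X3LemmaM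

open CategoryTheory AlgebraicGeometry TopologicalSpace IsLocalRing
open Literature.AlgebraicGeometry.Resolution
open Scheme.IdealSheafData

universe u

/-! ## §1 Local algebra: two parameters drop the dimension by two -/

/-- Arithmetic in `WithBot ℕ∞`: `a + 1 = b`, `b + 1 = c`, `c ≤ n + 2` ⟹ `a ≤ n`. [folklore] -/
theorem withBot_enat_le_of_succ_succ {a b c : WithBot ℕ∞} (h₁ : a + 1 = b) (h₂ : b + 1 = c) {n : ℕ} (hc : c ≤ (n : WithBot ℕ∞) + 2) :
    a ≤ n := by
  subst h₁; subst h₂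
  induction a using WithBot.recBotCoe with
  | bot => exact bot_le
  | coe a =>
    have hc' : ((a + 2 : ℕ∞) : WithBot ℕ∞) ≤ ((n + 2 : ℕ∞) : WithBot ℕ∞) := by
      have e1 : ((a : ℕ∞) : WithBot ℕ∞) + 1 + 1 = ((a + 2 : ℕ∞) : WithBot ℕ∞) := by
        rw [add_assoc]; norm_cast
      have e2 : (n : WithBot ℕ∞) + 2 = ((n + 2 : ℕ∞) : WithBot ℕ∞) := by norm_cast
      rwa [e1, e2] at hc
    have hc'' : (a + 2 : ℕ∞) ≤ n + 2 := WithBot.coe_le_coe.mp hc'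
    induction a using ENat.recTopCoe with
    | top => simp at hc''
    | coe a =>
      have : (a : ℕ∞) ≤ n := by
        have h3 : ((a + 2 : ℕ) : ℕ∞) ≤ ((n + 2 : ℕ) : ℕ∞) := by push_cast; exact hc''
        exact_mod_cast (by have := ENat.coe_le_coe.mp h3; omega)
      exact_mod_cast this

/-- [OURS · L1 W5.2 · cure §1b′] **TWO PARAMETERS DROP THE DIMENSION BY TWO.**  `R` regular local, `w ∈ 𝔪 ∖ 𝔪²`, `ψ ∈ 𝔪` with `ψ ∉ (w)`, and an
ideal `I ⊇ (w) + (ψ)`: if `dim R ≤ n + 2` then `dim R ⧸ I ≤ n`. [cite: Matsumura1987, Thm. 14.2, Thm. 17.4] -/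
theorem ringKrullDim_quot_le_of_two_parameters {R : Type*} [CommRing R] [IsRegularLocalRing R] {w ψ : R}
    (hw : w ∈ maximalIdeal R) (hw2 : w ∉ maximalIdeal R ^ 2) (hψ : ψ ∈ maximalIdeal R) (hψw : ψ ∉ Ideal.span {w})
    {I : Ideal R} (hI : Ideal.span {w} ⊔ Ideal.span {ψ} ≤ I) {n : ℕ} (hdim : ringKrullDim R ≤ (n : WithBot ℕ∞) + 2) :
    ringKrullDim (R ⧸ I) ≤ n := by
  haveI : IsDomain R := isDomain_of_isRegularLocalRing R
  have hw0 : w ≠ 0 := by rintro rfl; exact hw2 (Ideal.zero_mem _)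
  -- first quotient `R₁ := R ⧸ (w)`: a local domain of dimension `dim R - 1`
  have hprime : (Ideal.span {w}).IsPrime := (Ideal.span_singleton_prime hw0).mpr (IsRegularLocalRing.prime_of_not_mem_sq hw hw2)
  haveI : (Ideal.span {w}).IsPrime := hprime
  haveI : IsDomain (R ⧸ Ideal.span {w}) := Ideal.Quotient.isDomain _
  haveI : Nontrivial (R ⧸ Ideal.span {w}) := inferInstance
  haveI : IsLocalRing (R ⧸ Ideal.span {w}) := IsLocalRing.of_surjective' (Ideal.Quotient.mk _) Ideal.Quotient.mk_surjective
  have h1 : ringKrullDim (R ⧸ Ideal.span {w}) + 1 = ringKrullDim R :=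
    ringKrullDim_quotient_span_singleton_succ_eq_ringKrullDim (IsRegular.of_ne_zero hw0).left.isSMulRegular hw
  -- second quotient by `ψ̄ ≠ 0`, a non-unit
  set ψ₁ : R ⧸ Ideal.span {w} := Ideal.Quotient.mk _ ψ with hψ₁
  have hψ₁0 : ψ₁ ≠ 0 := fun h => hψw (Ideal.Quotient.eq_zero_iff_mem.mp h)
  have hψ₁m : ψ₁ ∈ maximalIdeal (R ⧸ Ideal.span {w}) := by
    rw [IsLocalRing.mem_maximalIdeal, mem_nonunits_iff]
    intro hu
    obtain ⟨u, hu⟩ := hu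
    obtain ⟨a, ha⟩ := Ideal.Quotient.mk_surjective (u⁻¹ : (R ⧸ Ideal.span {w})ˣ).1
    have h1' : Ideal.Quotient.mk (Ideal.span {w}) (ψ * a) = 1 := by
      rw [map_mul, ha, ← hψ₁, ← hu, Units.mul_inv]
    rw [← (Ideal.Quotient.mk (Ideal.span {w})).map_one, Ideal.Quotient.eq] at h1'
    have hmem : ψ * a - 1 ∈ maximalIdeal R := (Ideal.span_le.mpr (Set.singleton_subset_iff.mpr hw)) h1'
    have : (1 : R) ∈ maximalIdeal R := by
      have h3 := (maximalIdeal R).sub_mem (Ideal.mul_mem_right a _ hψ) hmem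
      rwa [sub_sub_cancel] at h3
    exact (maximalIdeal R).ne_top_iff_one.mp (maximalIdeal.isMaximal R).ne_top this
  have h2 : ringKrullDim ((R ⧸ Ideal.span {w}) ⧸ Ideal.span {ψ₁}) + 1 = ringKrullDim (R ⧸ Ideal.span {w}) :=
    ringKrullDim_quotient_span_singleton_succ_eq_ringKrullDim (IsRegular.of_ne_zero hψ₁0).left.isSMulRegular hψ₁m
  -- `(R/(w))/(ψ̄) ≅ R/((w)+(ψ))`, and `R/I` is a quotient of the latter
  have hmap : (Ideal.span {ψ}).map (Ideal.Quotient.mk (Ideal.span {w})) = Ideal.span {ψ₁} := by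
    rw [Ideal.map_span, Set.image_singleton]
  have e : ((R ⧸ Ideal.span {w}) ⧸ Ideal.span {ψ₁}) ≃+* R ⧸ (Ideal.span {w} ⊔ Ideal.span {ψ}) :=
    (Ideal.quotEquivOfEq hmap.symm).trans (DoubleQuot.quotQuotEquivQuotSup (Ideal.span {w}) (Ideal.span {ψ}))
  have h3 : ringKrullDim (R ⧸ I) ≤ ringKrullDim ((R ⧸ Ideal.span {w}) ⧸ Ideal.span {ψ₁}) := by
    rw [ringKrullDim_eq_of_ringEquiv e]
    exact ringKrullDim_le_of_surjective (Ideal.Quotient.factor hI) (Ideal.Quotient.factor_surjective hI)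
  exact h3.trans (withBot_enat_le_of_succ_succ h2 h1 hdim)

/-! ## §2 Stalks of products along a list -/

variable {X : Scheme.{u}}

/-- Membership in the support of a product along a list. [folklore] -/
theorem mem_support_list_prod_of_mem {l : List X.IdealSheafData} {Φ : X.IdealSheafData} (hΦ : Φ ∈ l) {z : X}
    (hz : z ∈ (Φ.support : Set X)) : z ∈ ((l.prod).support : Set X) := by
  induction l with
  | nil => exact absurd hΦ List.not_mem_nil
  | cons a l ih =>
    rw [List.prod_cons, Scheme.IdealSheafData.support_mul]
    rcases List.mem_cons.mp hΦ with rfl | h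
    · exact Or.inl hz
    · exact Or.inr (ih h)

/-- The stalk of a product along a list whose members have principal stalks is principal, generated by the product of the generators. [folklore] -/
theorem stalkIdeal_list_prod_eq_span (z : X) (φ : X.IdealSheafData → X.presheaf.stalk z) :
    ∀ (l : List X.IdealSheafData), (∀ Φ ∈ l, stalkIdeal Φ z = Ideal.span {φ Φ}) →
      stalkIdeal l.prod z = Ideal.span {(l.map φ).prod}
  | [], _ => by
    rw [List.prod_nil, List.map_nil, List.prod_nil, Ideal.span_singleton_one]
    exact stalkIdeal_top z
  | a :: l, h => by
    rw [List.prod_cons, List.map_cons, List.prod_cons, stalkIdeal_mul, h a List.mem_cons_self,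
      stalkIdeal_list_prod_eq_span z φ l (fun Φ hΦ => h Φ (List.mem_cons_of_mem a hΦ)), Ideal.span_singleton_mul_span_singleton]

/-! ## §3 The contact surface has dimension ≤ 2 -/

/-- The local ring of the closed subscheme `V(J)` at `y` has the dimension of `𝒪_{W,ι y} ⧸ J_{ι y}`. [cite: GortzWedhorn2020, Lemma 5.7 (4)] -/
theorem ringKrullDim_stalk_subscheme_eq {W : Scheme.{u}} (J : W.IdealSheafData) (y : J.subscheme) :
    ringKrullDim (J.subscheme.presheaf.stalk y) =
      ringKrullDim ((W.presheaf.stalk (J.subschemeι.base y)) ⧸ stalkIdeal J (J.subschemeι.base y)) := by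
  have hker : J.subschemeι.ker ≤ J := (Scheme.IdealSheafData.ker_subschemeι J).le
  obtain ⟨e⟩ := ContactRealisation.nonempty_ringEquiv_quot_comap_of_ker_le J.subschemeι J hker y
  have h0 : stalkIdeal (J.comap J.subschemeι) y = ⊥ := by
    rw [stalkIdeal_comap_eq_map_stalkMap, Ideal.map_eq_bot_iff_le_ker, ← stalkIdeal_ker_eq_ker_stalkMap,
      Scheme.IdealSheafData.ker_subschemeι]
  let e' : ((W.presheaf.stalk (J.subschemeι.base y)) ⧸ stalkIdeal J (J.subschemeι.base y)) ≃+* J.subscheme.presheaf.stalk y :=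
    (e.trans (Ideal.quotEquivOfEq h0)).trans (RingEquiv.quotientBot _)
  exact (ringKrullDim_eq_of_ringEquiv e').symm

/-- [OURS · L1 W5.2 · cure §1b′] **THE CONTACT SURFACE HAS DIMENSION ≤ 2** (the hypothesis `hdim` of `exists_realisedCure_of_F60`), from K21 and the
patch-uniform rev-6 contact data at every point of `Sfc ∩ W`. [cite: Matsumura1987, Thm. 17.4] [cite: GortzWedhorn2020, Lemma 5.7 (4)] -/
theorem topologicalKrullDim_contactSurface_le_two [IsNoetherian X] (hX : Scheme.IsRegular X) (hK21 : topologicalKrullDim X ≤ 4)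
    (Sfc : Set X) (hSfc : IsClosed Sfc) (W : X.Opens)
    (hcov : ∀ z ∈ Sfc, z ∈ (W : Set X) → ∃ (V : X.IdealSheafData) (𝓒 : List X.IdealSheafData) (W' : X.Opens),
      z ∈ (W' : Set X) ∧ z ∈ (V.support : Set X) ∧
      (∃ w : X.presheaf.stalk z, w ∉ (maximalIdeal (X.presheaf.stalk z)) ^ 2 ∧ stalkIdeal V z = Ideal.span {w}) ∧
      (∀ Φ ∈ 𝓒, ∃ φ : X.presheaf.stalk z, stalkIdeal Φ z = Ideal.span {φ}) ∧
      (∀ Φ ∈ 𝓒, Φ ≠ V → z ∈ (Φ.support : Set X) → ¬ stalkIdeal Φ z ≤ stalkIdeal V z) ∧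
      Sfc ∩ (W' : Set X) ⊆ (V.support : Set X) ∩ ⋃ Φ ∈ 𝓒, ⋃ (_ : Φ ≠ V), (Φ.support : Set X)) :
    topologicalKrullDim (vanishingIdeal ((⟨Sfc, hSfc⟩ : Closeds X).preimage W.ι.continuous)).subscheme ≤ 2 := by
  classical
  set J : (W : Scheme.{u}).IdealSheafData := vanishingIdeal ((⟨Sfc, hSfc⟩ : Closeds X).preimage W.ι.continuous) with hJ
  rw [Literature.AlgebraicGeometry.Motives.Scheme.topologicalKrullDim_eq_iSup_ringKrullDim_stalk]
  refine iSup_le fun y => ?_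
  -- the point and its image in `X`
  set z₀ : (W : Scheme.{u}) := J.subschemeι.base y with hz₀
  set z : X := W.ι.base z₀ with hz
  have hz₀S : z₀ ∈ W.ι.base ⁻¹' Sfc := by
    have : z₀ ∈ Set.range J.subschemeι.base := ⟨y, rfl⟩
    rw [Scheme.IdealSheafData.range_subschemeι, hJ, Scheme.IdealSheafData.coe_support_vanishingIdeal] at this
    exact this
  have hzS : z ∈ Sfc := hz₀S
  have hzW : z ∈ (W : Set X) := by rw [← Scheme.Opens.range_ι W]; exact ⟨z₀, rfl⟩
  -- `dim 𝒪_{V(J),y} = dim 𝒪_{W,z₀}/J_{z₀} = dim 𝒪_{X,z}/𝓘(Sfc)_z`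
  rw [ringKrullDim_stalk_subscheme_eq J y]
  have hJc : J = (vanishingIdeal (⟨Sfc, hSfc⟩ : Closeds X)).comap W.ι := by
    rw [comap_vanishingIdeal_of_isOpenImmersion]
  obtain ⟨eq⟩ := ContactRealisation.nonempty_ringEquiv_quot_of_isIso_stalkMap W.ι (vanishingIdeal (⟨Sfc, hSfc⟩ : Closeds X)) z₀
  rw [← hJc] at eq
  rw [← hz₀, ← ringKrullDim_eq_of_ringEquiv eq]
  change ringKrullDim ((X.presheaf.stalk z) ⧸ stalkIdeal (vanishingIdeal (⟨Sfc, hSfc⟩ : Closeds X)) z) ≤ 2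
  -- the rev-6 data at `z`
  obtain ⟨V, 𝓒, W', hzW', hzV, ⟨w, hw2, hVw⟩, hprin, hNF0, hsub⟩ := hcov z hzS hzW
  haveI : IsRegularLocalRing (X.presheaf.stalk z) := hX z
  -- generators of the entries at `z` and their product over the entries `≠ V`
  let φ : X.IdealSheafData → X.presheaf.stalk z := fun Φ => if h : Φ ∈ 𝓒 then (hprin Φ h).choose else 1
  have hφ : ∀ Φ ∈ 𝓒, stalkIdeal Φ z = Ideal.span {φ Φ} := by
    intro Φ hΦ
    simp only [φ, dif_pos hΦ]
    exact (hprin Φ hΦ).choose_spec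
  set 𝓒' := 𝓒.filter fun Φ => decide (Φ ≠ V) with h𝓒'
  have h𝓒'sub : ∀ Φ ∈ 𝓒', Φ ∈ 𝓒 ∧ Φ ≠ V := fun Φ hΦ => by simpa using List.mem_filter.mp hΦ
  set ψ := (𝓒'.map φ).prod with hψ
  have h𝓟 : stalkIdeal 𝓒'.prod z = Ideal.span {ψ} :=
    stalkIdeal_list_prod_eq_span z φ 𝓒' fun Φ hΦ => hφ Φ (h𝓒'sub Φ hΦ).1
  -- `w ∈ 𝔪`, `ψ ∈ 𝔪`, `ψ ∉ (w)`
  have hwm : w ∈ maximalIdeal (X.presheaf.stalk z) := by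
    have := (mem_support_iff_stalkIdeal_le V z).mp hzV
    rw [hVw] at this
    exact this (Ideal.mem_span_singleton_self w)
  have hzU : z ∈ Sfc ∩ (W' : Set X) := ⟨hzS, hzW'⟩
  obtain ⟨-, hzU'⟩ := hsub hzU
  simp only [Set.mem_iUnion, exists_prop] at hzU'
  obtain ⟨Φ₀, hΦ₀𝓒, hΦ₀V, hzΦ₀⟩ := hzU'
  have hψm : ψ ∈ maximalIdeal (X.presheaf.stalk z) := by
    have hΦ₀' : Φ₀ ∈ 𝓒' := List.mem_filter.mpr ⟨hΦ₀𝓒, by simpa using hΦ₀V⟩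
    have hdvd : φ Φ₀ ∣ ψ := List.dvd_prod (List.mem_map.mpr ⟨Φ₀, hΦ₀', rfl⟩)
    obtain ⟨c, hc⟩ := hdvd
    rw [hc]
    refine Ideal.mul_mem_right c _ ?_
    have := (mem_support_iff_stalkIdeal_le Φ₀ z).mp hzΦ₀
    rw [hφ Φ₀ hΦ₀𝓒] at this
    exact this (Ideal.mem_span_singleton_self _)
  have hw0 : w ≠ 0 := by rintro rfl; exact hw2 (Ideal.zero_mem _)
  have hwprime : Prime w := IsRegularLocalRing.prime_of_not_mem_sq hwm hw2
  have hψw : ψ ∉ Ideal.span {w} := by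
    intro hmem
    have hdvd : w ∣ ψ := Ideal.mem_span_singleton.mp hmem
    obtain ⟨a, ha, hwa⟩ := hwprime.dvd_prod_iff.mp hdvd
    obtain ⟨Φ, hΦ', rfl⟩ := List.mem_map.mp ha
    obtain ⟨hΦ𝓒, hΦV⟩ := h𝓒'sub Φ hΦ'
    have hle : stalkIdeal Φ z ≤ stalkIdeal V z := by
      rw [hφ Φ hΦ𝓒, hVw, Ideal.span_singleton_le_iff_mem]
      exact Ideal.mem_span_singleton.mpr hwa
    by_cases hzΦ : z ∈ (Φ.support : Set X)
    · exact hNF0 Φ hΦ𝓒 hΦV hzΦ hle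
    · exact hzΦ ((mem_support_iff_stalkIdeal_le Φ z).mpr (hle.trans ((mem_support_iff_stalkIdeal_le V z).mp hzV)))
  -- `𝓘(Sfc)_z ⊇ (w) + (ψ)`: on `W'`, `Sfc` sits inside the support of `V ⊔ ∏ Φ`
  have hI : Ideal.span {w} ⊔ Ideal.span {ψ} ≤ stalkIdeal (vanishingIdeal (⟨Sfc, hSfc⟩ : Closeds X)) z := by
    set T : Closeds X := (V ⊔ 𝓒'.prod).support with hT
    set C : Closeds X := ⟨(W' : Set X)ᶜ, W'.isOpen.isClosed_compl⟩ with hC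
    have hSfcTC : ((⟨Sfc, hSfc⟩ : Closeds X) : Set X) ⊆ ((T ⊔ C : Closeds X) : Set X) := by
      intro p hp
      rw [Closeds.coe_sup]
      by_cases hpW' : p ∈ (W' : Set X)
      · left
        rw [hT, Scheme.IdealSheafData.support_sup]
        obtain ⟨hpV, hpU⟩ := hsub ⟨hp, hpW'⟩
        simp only [Set.mem_iUnion, exists_prop] at hpU
        obtain ⟨Φ, hΦ𝓒, hΦV, hpΦ⟩ := hpU
        exact ⟨hpV, mem_support_list_prod_of_mem (List.mem_filter.mpr ⟨hΦ𝓒, by simpa using hΦV⟩) hpΦ⟩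
      · right; exact hpW'
    have h1 : stalkIdeal (vanishingIdeal (T ⊔ C)) z ≤ stalkIdeal (vanishingIdeal (⟨Sfc, hSfc⟩ : Closeds X)) z :=
      stalkIdeal_mono (vanishingIdeal_antimono hSfcTC) z
    have h2 : stalkIdeal (vanishingIdeal (T ⊔ C)) z = stalkIdeal (vanishingIdeal T) z := by
      rw [vanishingIdeal_sup, stalkIdeal_inf]
      have hzC : z ∉ ((vanishingIdeal C).support : Set X) := by
        rw [Scheme.IdealSheafData.coe_support_vanishingIdeal, hC]
        exact fun h => h hzW'
      rw [stalkIdeal_eq_top_of_not_mem_support hzC, inf_top_eq]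
    have h3 : stalkIdeal (V ⊔ 𝓒'.prod) z ≤ stalkIdeal (vanishingIdeal T) z :=
      stalkIdeal_mono (Scheme.IdealSheafData.gc.le_u_l (V ⊔ 𝓒'.prod)) z
    rw [stalkIdeal_sup, hVw, h𝓟] at h3
    rw [← h2] at h3
    exact h3.trans h1
  -- conclude by the local algebra with `dim 𝒪_{X,z} ≤ 4`
  have hdimz : ringKrullDim (X.presheaf.stalk z) ≤ ((2 : ℕ) : WithBot ℕ∞) + 2 := by
    have := (ringKrullDim_stalk_le_topologicalKrullDim X z).trans hK21
    exact this.trans (by norm_num)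
  exact_mod_cast ringKrullDim_quot_le_of_two_parameters hwm hw2 hψm hψw hI hdimz

end Summit.ResolutionOfSingularities.ResolutionOfSingularities.Theorems.X3LemmaM

end
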